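import Literature.MathematicalPhysics.QuantumFieldTheory.Balaban1983to89.Node00.DressedClassTelescoping
import Literature.MathematicalPhysics.QuantumFieldTheory.Balaban1983to89.Node00.RStepProvisosIntOfRecord

/-!
# NODE 00 — THE CLASS-WISE TELESCOPING OF THE (2.18) CLASS WEIGHTS OF A DATUM IN THE INTEGRABLE PROVISO FORM: the 𝐑-half re-books class weights along its
# selector under def-R's `ProvisosInt` reading of [IV] (0.3) p. 176 (pieces integrable, non-negative, SUPPORT CLAUSE almost everywhere — no uniform bound, no
# nowhere-vanishing denominators); hence hypothesis (T) of the N20 tower sockets from unity + 𝐓-side provisos + the INTEGRABLE (0.3) provisos + the pin, and —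
# at a level where the selector is the IDENTITY — from unity + 𝐓-side provisos + integrable non-negative measurable pieces ALONE (support clause automatic, pin void)

Cell `pub-ymgap`, YM-PLAN Track A (HUMAN RULING D-0062); author seat `pub-ymgap-dag-n20-d` (g37, the N20 lineage).  The Int-form twin of this lineage's
`Node00/RStepFibreMass` (𝐑-half under the POINTWISE provisos: bounded pieces, denominators nowhere zero — b01's `integral_normTerm_eq`) and
`Node00/DressedClassTelescoping` (★★★ `sum_fiber_classWeightOfDatum₉_succ_eq`), on def-R's FILE 17 `Node00/RStepProvisosIntOfRecord` (`integral_normTerm_eq_int`,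
`integrable_normTerm_int`, `suppClause_self_ae`; the form `RepData.ProvisosInt` that the Stage-13 records KEY in row `rstep`, e.g. `Stage13HParams.Provisos₁₃CoPH.rstep`).
[IV] = [Balaban1989LargeFieldI]; [III] = [Balaban1988Convergent].

WHY THE INT FORM.  The pointwise form's «`∫⌈_{Z′(s′)} t_{sel s′} ≠ 0` at EVERY `V`» fails at every DEAD sequence (a sequence whose piece vanishes identically — e.g. an
inconsistent chain of regions, `χ ≡ 0`), even at the identity selector; the records therefore display (0.3)'s «the denominators are positive» as the a.e. SUPPORT
CLAUSE «`∫⌈_{Z′(s′)} t_{sel s′} = 0 at V ⇒ t_{s′}(V) = 0`» (`RepData.ProvisosInt`, third conjunct), under which (0.4) holds term by term (FILE 17 §1).  This file moves the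
𝐑-half and (T) to that form, so that (T) can be read off a record's own rows.

WHAT IS PROVED (finite-sum algebra on FILE 17's per-term identity; def-R's TS-8 instance convention as in `RStepFibreMass`: the bond-decidability instance is an explicit
binder `iP` of the generic lemmas, instantiated by unification at def-R's terms of record; hypotheses stated over the importing context's instance are handed over by
`convert`, the two `DecidableEq (PBond …)` inhabitants being equal).
* §1 (generic over `Step.Repr218 P G j`, `sel`, `fib`): ★ `integral_chi_mul_rstepOfSel_TexpA_int` (`∫ χ(a′)·(𝐓e^A)′(a′) = Σ_{sel a = a′} ∫ t_a` under: pieces measurable,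
  non-negative, integrable; support clause a.e.), ★★ `sum_filter_integral_chi_mul_rstepOfSel_TexpA_int` (a label-preserving selector conserves every labelled class).
* §2 (of record): ★★ `sum_filter_integral_chi_mul_rstepSlot_int` (labelling `Seq.init`).
* §3 ★★★ `sum_fiber_classWeightOfDatum₉_succ_eq_int`: (T) `Σ_{s′.init = π} classWeightOfDatum₉ ϑ D g₀ os p g (m+1) t s′ = classWeightOfDatum₉ … m t π` (`m < p.K`) from unity,
  the 𝐓-side provisos (integrable dressed piece of `π`; `|w| ≤ 1` jointly measurable; `χ_{m+1}` measurable), the INTEGRABLE (0.3) provisos on the pre-𝐑 dressed family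
  (pieces measurable, non-negative, integrable; support clause a.e. at the selected targets) and the pin; ★★★ `sum_fiber_classWeightOfDatum₉_succ_eq_of_sel_id`: at a
  level where `ϑ.ppSel p g (m+1)` is the identity, the support clause is AUTOMATIC (`suppClause_self_ae`) and the pin VOID — (T) from unity + 𝐓-side provisos +
  measurable non-negative integrable pre-𝐑 pieces.

HONEST FRAMING.  Every proviso is a HYPOTHESIS, displayed; nothing of Bałaban's asserted; no estimate; no `Provisos…` inhabitant claimed; whether a given record's tuple is
identity- or live-pinned is NOT decided here.  Counts UNMOVED (typed 28∕28 · discharged 8∕27); one finite four-torus programme at fixed `ε` — NOT ℝ⁴ ∕ OS ∕ mass gap ∕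
Clay.  No `def`, no `sorry`, no `axiom`, no `instance`, no `notation`.
-/

noncomputable section

open MeasureTheory
open scoped BigOperators

namespace Literature.MathematicalPhysics.QuantumFieldTheory.Balaban1983to89.Node00

open T4Continuum B14.Eq218Concrete B15RopTotal T4FiniteEpsInhabited
open B15.BasicStep (fibreIntegral normTerm integral_normTerm_eq_int integrable_normTerm_int suppClause_self_ae)

/-! ## §1 Generic: the 𝐑-step re-books class weights along its selector, integrable proviso form -/

section Generic

variable {P : Params} {G : Type*} [GaugeGroup G] [MeasurableSpace G] [HaarData G] {j : ℕ}

open scoped Classical in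
/-- ★ **THE 𝐑-STEP RE-BOOKS CLASS WEIGHTS ALONG ITS SELECTOR — INTEGRABLE PROVISO FORM.**  Under the (0.3) provisos on the terms `t_a = χ(a)·(𝐓e^A)(a)` READ AS
def-R's `ProvisosInt` (measurable, non-negative, INTEGRABLE; and the a.e. support clause at the selected targets «`∫⌈_{Z′(a)} t_{sel a} = 0 at V ⇒ t_a(V) = 0`»), the post-𝐑 class
weight of `a′` is the sum of the pre-𝐑 class weights of its preimage: `∫ χ(a′)·(𝐓e^A)′(a′) = Σ_{sel a = a′} ∫ t_a` (FILE 17's `integral_normTerm_eq_int` summand by summand;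
`RStepFibreMass.integral_chi_mul_rstepOfSel_TexpA` is the pointwise-form twin). [cite: Balaban1989LargeFieldI, (0.3)–(0.4) p.176, (1.102) p.201] -/
theorem integral_chi_mul_rstepOfSel_TexpA_int (iP : DecidableEq (PBond P j)) (r : Step.Repr218 P G j) (sel : r.Adm → r.Adm)
    (fib : r.Adm → Finset (PBond P j)) (hm : ∀ a, Measurable (rterm r a)) (h0 : ∀ a V, 0 ≤ rterm r a V)
    (hint : ∀ a, Integrable (rterm r a) (fieldMeasure P j G))
    (hsupp : ∀ a, ∀ᵐ V ∂(fieldMeasure P j G), fibreIntegral (fib a) (rterm r (sel a)) V = 0 → rterm r a V = 0) (a' : r.Adm) :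
    ∫ V, r.χ a' V * (rstepOfSel r sel fib).TexpA a' V ∂(fieldMeasure P j G) =
      ∑ a ∈ Finset.univ.filter (fun a => sel a = a'), ∫ V, rterm r a V ∂(fieldMeasure P j G) := by
  have hsupp' : ∀ a ∈ Finset.univ.filter (fun a => sel a = a'),
      ∀ᵐ V ∂(fieldMeasure P j G), fibreIntegral (fib a) (rterm r a') V = 0 → rterm r a V = 0 := by
    intro a ha
    have hsa : sel a = a' := (Finset.mem_filter.1 ha).2
    rw [← hsa]
    exact hsupp a
  have hint' : ∀ a ∈ Finset.univ.filter (fun a => sel a = a'),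
      Integrable (normTerm (fib a) (rterm r a') (rterm r a)) (fieldMeasure P j G) := fun a ha =>
    integrable_normTerm_int (fib a) (hm a') (hm a) (h0 a') (h0 a) (hint a') (hint a) (hsupp' a ha)
  calc ∫ V, r.χ a' V * (rstepOfSel r sel fib).TexpA a' V ∂(fieldMeasure P j G)
      = ∫ V, ∑ a ∈ Finset.univ.filter (fun a => sel a = a'), normTerm (fib a) (rterm r a') (rterm r a) V ∂(fieldMeasure P j G) :=
        integral_congr_ae (ae_of_all _ fun V => chi_mul_rstepOfSel_TexpA_eq_sum_normTerm iP r sel fib a' V)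
    _ = ∑ a ∈ Finset.univ.filter (fun a => sel a = a'), ∫ V, normTerm (fib a) (rterm r a') (rterm r a) V ∂(fieldMeasure P j G) :=
        integral_finsetSum _ hint'
    _ = ∑ a ∈ Finset.univ.filter (fun a => sel a = a'), ∫ V, rterm r a V ∂(fieldMeasure P j G) :=
        Finset.sum_congr rfl fun a ha => integral_normTerm_eq_int (fib a) (hm a') (hm a) (h0 a') (h0 a) (hint a') (hint a) (hsupp' a ha)

open scoped Classical in
/-- ★★ **A PREFIX-PRESERVING SELECTOR CONSERVES EVERY LABELLED CLASS — INTEGRABLE PROVISO FORM.**  With a labelling `pre` of the index and a selector preserving the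
label of every sequence of non-zero mass (`pre (sel a) = pre a`, or `∫ t_a = 0`), under the provisos of `integral_chi_mul_rstepOfSel_TexpA_int`:
`Σ_{pre a′ = q} ∫ χ(a′)·(𝐓e^A)′(a′) = Σ_{pre a = q} ∫ t_a` for every label `q` (`Finset.sum_fiberwise_eq_sum_filter`; the pointwise-form twin is
`RStepFibreMass.sum_filter_integral_chi_mul_rstepOfSel_TexpA`, proof verbatim). [cite: Balaban1989LargeFieldI, (0.3)–(0.4) p.176] -/
theorem sum_filter_integral_chi_mul_rstepOfSel_TexpA_int (iP : DecidableEq (PBond P j)) (r : Step.Repr218 P G j) (sel : r.Adm → r.Adm)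
    (fib : r.Adm → Finset (PBond P j)) (hm : ∀ a, Measurable (rterm r a)) (h0 : ∀ a V, 0 ≤ rterm r a V)
    (hint : ∀ a, Integrable (rterm r a) (fieldMeasure P j G))
    (hsupp : ∀ a, ∀ᵐ V ∂(fieldMeasure P j G), fibreIntegral (fib a) (rterm r (sel a)) V = 0 → rterm r a V = 0)
    {Q : Type*} (pre : r.Adm → Q) (hsel : ∀ a, pre (sel a) = pre a ∨ ∫ V, rterm r a V ∂(fieldMeasure P j G) = 0) (q : Q) :
    ∑ a' ∈ Finset.univ.filter (fun a' => pre a' = q), ∫ V, r.χ a' V * (rstepOfSel r sel fib).TexpA a' V ∂(fieldMeasure P j G) =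
      ∑ a ∈ Finset.univ.filter (fun a => pre a = q), ∫ V, rterm r a V ∂(fieldMeasure P j G) := by
  calc ∑ a' ∈ Finset.univ.filter (fun a' => pre a' = q), ∫ V, r.χ a' V * (rstepOfSel r sel fib).TexpA a' V ∂(fieldMeasure P j G)
      = ∑ a' ∈ Finset.univ.filter (fun a' => pre a' = q),
          ∑ a ∈ Finset.univ.filter (fun a => sel a = a'), ∫ V, rterm r a V ∂(fieldMeasure P j G) :=
        Finset.sum_congr rfl fun a' _ => integral_chi_mul_rstepOfSel_TexpA_int iP r sel fib hm h0 hint hsupp a'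
    _ = ∑ a ∈ Finset.univ.filter (fun a => sel a ∈ Finset.univ.filter (fun a' => pre a' = q)),
          ∫ V, rterm r a V ∂(fieldMeasure P j G) :=
        Finset.sum_fiberwise_eq_sum_filter _ _ _ _
    _ = ∑ a, if pre (sel a) = q then ∫ V, rterm r a V ∂(fieldMeasure P j G) else 0 := by
        rw [Finset.sum_filter]
        refine Finset.sum_congr rfl fun a _ => ?_
        simp only [Finset.mem_filter, Finset.mem_univ, true_and]
    _ = ∑ a, if pre a = q then ∫ V, rterm r a V ∂(fieldMeasure P j G) else 0 := by
        refine Finset.sum_congr rfl fun a _ => ?_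
        rcases hsel a with h | h
        · rw [h]
        · rw [h]
          split_ifs <;> rfl
    _ = ∑ a ∈ Finset.univ.filter (fun a => pre a = q), ∫ V, rterm r a V ∂(fieldMeasure P j G) := by
        rw [Finset.sum_filter]

end Generic

/-! ## §2 Of record: def-R's slots, labelling `Seq.init`, integrable proviso form -/

variable (F : T4Family) (N : ℕ) [NeZero N]

open scoped Classical in
/-- ★★ **THE 𝐑-STEP OF RECORD ON SLOTS CONSERVES EVERY `init`-FIBRE SUM OF CLASS WEIGHTS — integrable proviso form, for a selector that preserves the prefix of every
massive sequence.**  At def-R's slot face (`rstepSlot … sel f`, front factors `chiSeqOfRecord`, terms `t_s = χ_k(s)·f(s)`), under: pieces measurable, non-negative,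
integrable; the a.e. support clause «`∫⌈_{Z′(s)} t_{sel s} = 0 at V ⇒ t_s(V) = 0`» (def-R's `ProvisosInt` of the tower datum, `provisosInt_towerRepOfRecord_iff`); and
`(sel s).init = s.init ∨ ∫ t_s = 0` for every `s`:  `Σ_{s′.init = π} ∫ χ_k(s′)·(rstepSlot … sel f)(s′) = Σ_{s′.init = π} ∫ χ_k(s′)·f(s′)`.  The support clause may be stated over
any bond-decidability instance (handed to def-R's by `convert`). [cite: Balaban1989LargeFieldI, (0.3)–(0.4) p.176] -/
theorem sum_filter_integral_chi_mul_rstepSlot_int (ν : Stage7Numerics) (τ : TowerNumerics) (p : B12.RunParams) (g : ℕ → ℝ) (k : ℕ)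
    (sel : SeqOfRecord F ν τ.M g p.K (k + 1) → SeqOfRecord F ν τ.M g p.K (k + 1)) (f : TexpASlot F N ν τ.M p g (k + 1))
    (hm : ∀ s, Measurable (fun V => chiSeqOfRecord F N ν τ.M g p.K (k + 1) s V * f s V))
    (h0 : ∀ s V, 0 ≤ chiSeqOfRecord F N ν τ.M g p.K (k + 1) s V * f s V)
    (hint : ∀ s, Integrable (fun V => chiSeqOfRecord F N ν τ.M g p.K (k + 1) s V * f s V) (fieldMeasure (F.P p.K) (k + 1) (SU N)))
    {iP : DecidableEq (PBond (F.P p.K) (k + 1))}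
    (hsupp : ∀ s, ∀ᵐ V ∂(fieldMeasure (F.P p.K) (k + 1) (SU N)),
      fibreIntegral (fibOfSeq F ν τ p g (k + 1) s) (fun V => chiSeqOfRecord F N ν τ.M g p.K (k + 1) (sel s) V * f (sel s) V) V = 0 →
        chiSeqOfRecord F N ν τ.M g p.K (k + 1) s V * f s V = 0)
    (hsel : ∀ s, (sel s).init = s.init ∨
      ∫ V, chiSeqOfRecord F N ν τ.M g p.K (k + 1) s V * f s V ∂(fieldMeasure (F.P p.K) (k + 1) (SU N)) = 0)
    (π : SeqOfRecord F ν τ.M g p.K k) :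
    ∑ s' ∈ Finset.univ.filter (fun s' : SeqOfRecord F ν τ.M g p.K (k + 1) => s'.init = π),
        ∫ V, chiSeqOfRecord F N ν τ.M g p.K (k + 1) s' V * rstepSlot F N ν τ p g (k + 1) sel f s' V ∂(fieldMeasure (F.P p.K) (k + 1) (SU N)) =
      ∑ s' ∈ Finset.univ.filter (fun s' : SeqOfRecord F ν τ.M g p.K (k + 1) => s'.init = π),
        ∫ V, chiSeqOfRecord F N ν τ.M g p.K (k + 1) s' V * f s' V ∂(fieldMeasure (F.P p.K) (k + 1) (SU N)) := by
  unfold rstepSlot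
  refine sum_filter_integral_chi_mul_rstepOfSel_TexpA_int _ (sliceOfRecord F N ν τ.M p g (k + 1) f) sel (fibOfSeq F ν τ p g (k + 1))
    hm h0 hint (fun s => ?_) Seq.init hsel π
  convert hsupp s using 5 <;> rfl

/-! ## §3 At a Stage-9 tuple: (T) for the dressed class weights of a datum, integrable proviso form; and at an identity-pinned level -/

open scoped Classical in
/-- ★★★ **CLASS-WISE TELESCOPING OF THE DRESSED (2.18) CLASS WEIGHTS FROM THE DISPLAYED PROVISOS — INTEGRABLE (0.3) FORM.**  For a Stage-9 tuple `ϑ`, datum `D`, `g₀, os`, run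
`p`, couplings `g`, level `m < p.K`, source `t`, level-`m` sequence `π`: IF (unity) `IsStepUnity` holds for `wOfRecord₉ ϑ p g m`; (𝐓-side) the dressed piece `χ_m(π)·slot_m(π)` is
integrable, the step weights are jointly measurable with `|w| ≤ 1`, the level-`(m+1)` front factors are measurable; (𝐑-side, [IV] (0.3) READ AS `ProvisosInt`) the PRE-𝐑 dressed
pieces `χ_{m+1}(s′)·(𝐓-step slot_m)(s′)` are measurable, non-negative, INTEGRABLE, and satisfy the a.e. support clause at the selected targets; and (pin) `ϑ.ppSel p g (m+1)`
preserves the prefix of every massive pre-𝐑 sequence — THEN `Σ_{s′.init = π} classWeightOfDatum₉ ϑ D g₀ os p g (m+1) t s′ = classWeightOfDatum₉ ϑ D g₀ os p g m t π`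
(`TStepFibreMass.sum_fiber_integral_chi_tstepOfRecord` ∘ §2; the pointwise-form twin is `DressedClassTelescoping.sum_fiber_classWeightOfDatum₉_succ_eq`).
[cite: Balaban1988Convergent, (2.18) p.257, (3.24)–(3.25) p.270; Balaban1989LargeFieldI, (0.3)–(0.4) p.176] -/
theorem sum_fiber_classWeightOfDatum₉_succ_eq_int (ϑ : Stage9Params F N) (D : FiniteEpsData F (SU N)) (g₀ : ℕ → ℝ) (os : List (ULoop F))
    (p : B12.RunParams) (g : ℕ → ℝ) (m : ℕ) (hm : m < p.K) (t : ℝ) (π : SeqOfRecord F ϑ.ν ϑ.τ9.M g p.K m)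
    -- unity of the step weights of record between the front factors of levels `m`, `m + 1`
    (hunit : IsStepUnity (avOfRecord F N p.K m).avg (chiSeqOfRecord F N ϑ.ν ϑ.τ9.M g p.K m)
      (chiSeqOfRecord F N ϑ.ν ϑ.τ9.M g p.K (m + 1)) (wOfRecord₉ F N ϑ p g m))
    -- 𝐓-side provisos
    (hT : Integrable (fun U => chiSeqOfRecord F N ϑ.ν ϑ.τ9.M g p.K m π U * dressedSlotsOfDatum₉ F N ϑ D g₀ os t p g m π U)
      (fieldMeasure (F.P p.K) m (SU N)))
    (hw : ∀ s', Measurable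
      (fun z : GaugeField (F.P p.K) (m + 1) (SU N) × GaugeField (F.P p.K) m (SU N) => wOfRecord₉ F N ϑ p g m s' z.2 z.1))
    (hwb : ∀ s' U V', |wOfRecord₉ F N ϑ p g m s' U V'| ≤ 1)
    (hχ : ∀ s', Measurable (chiSeqOfRecord F N ϑ.ν ϑ.τ9.M g p.K (m + 1) s'))
    -- 𝐑-side provisos on the PRE-𝐑 dressed family at level `m + 1`, integrable form
    (hm' : ∀ s', Measurable (fun V => chiSeqOfRecord F N ϑ.ν ϑ.τ9.M g p.K (m + 1) s' V *
      tstepOfRecord F N ϑ.ν ϑ.τ9.M (wOfRecord₉ F N ϑ) p g m (dressedSlotsOfDatum₉ F N ϑ D g₀ os t p g m) s' V))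
    (h0' : ∀ s' V, 0 ≤ chiSeqOfRecord F N ϑ.ν ϑ.τ9.M g p.K (m + 1) s' V *
      tstepOfRecord F N ϑ.ν ϑ.τ9.M (wOfRecord₉ F N ϑ) p g m (dressedSlotsOfDatum₉ F N ϑ D g₀ os t p g m) s' V)
    (hint' : ∀ s', Integrable (fun V => chiSeqOfRecord F N ϑ.ν ϑ.τ9.M g p.K (m + 1) s' V *
      tstepOfRecord F N ϑ.ν ϑ.τ9.M (wOfRecord₉ F N ϑ) p g m (dressedSlotsOfDatum₉ F N ϑ D g₀ os t p g m) s' V) (fieldMeasure (F.P p.K) (m + 1) (SU N)))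
    (hsupp' : ∀ s', ∀ᵐ V ∂(fieldMeasure (F.P p.K) (m + 1) (SU N)),
      fibreIntegral (fibOfSeq F ϑ.ν ϑ.τ9 p g (m + 1) s')
        (fun V => chiSeqOfRecord F N ϑ.ν ϑ.τ9.M g p.K (m + 1) (ϑ.ppSel p g (m + 1) s') V *
          tstepOfRecord F N ϑ.ν ϑ.τ9.M (wOfRecord₉ F N ϑ) p g m (dressedSlotsOfDatum₉ F N ϑ D g₀ os t p g m) (ϑ.ppSel p g (m + 1) s') V) V = 0 →
      chiSeqOfRecord F N ϑ.ν ϑ.τ9.M g p.K (m + 1) s' V *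
        tstepOfRecord F N ϑ.ν ϑ.τ9.M (wOfRecord₉ F N ϑ) p g m (dressedSlotsOfDatum₉ F N ϑ D g₀ os t p g m) s' V = 0)
    -- the pin: the selector preserves the prefix of every massive pre-𝐑 sequence
    (hsel : ∀ s', (ϑ.ppSel p g (m + 1) s').init = s'.init ∨
      ∫ V, chiSeqOfRecord F N ϑ.ν ϑ.τ9.M g p.K (m + 1) s' V *
        tstepOfRecord F N ϑ.ν ϑ.τ9.M (wOfRecord₉ F N ϑ) p g m (dressedSlotsOfDatum₉ F N ϑ D g₀ os t p g m) s' V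
          ∂(fieldMeasure (F.P p.K) (m + 1) (SU N)) = 0) :
    ∑ s' ∈ Finset.univ.filter (fun s' : SeqOfRecord F ϑ.ν ϑ.τ9.M g p.K (m + 1) => s'.init = π),
        classWeightOfDatum₉ F N ϑ D g₀ os p g (m + 1) t s' = classWeightOfDatum₉ F N ϑ D g₀ os p g m t π := by
  -- the slot recursion of record: `slot_{m+1} = 𝐑_{m+1}(𝐓-step slot_m)` (`texpAOfRecordFrom_succ`), `𝐑` of record as the slot operation at `ϑ.ppSel p g (m+1)`
  have hrec : dressedSlotsOfDatum₉ F N ϑ D g₀ os t p g (m + 1) =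
      rstepSlotOfRecord F N ϑ.ν ϑ.τ9 ϑ.ppSel p g (m + 1)
        (tstepOfRecord F N ϑ.ν ϑ.τ9.M (wOfRecord₉ F N ϑ) p g m (dressedSlotsOfDatum₉ F N ϑ D g₀ os t p g m)) :=
    texpAOfRecordFrom_succ F N ϑ.ν ϑ.τ9.M _ (wOfRecord₉ F N ϑ) (rstepSlotOfRecord F N ϑ.ν ϑ.τ9 ϑ.ppSel) p g m
  have hR : rstepSlotOfRecord F N ϑ.ν ϑ.τ9 ϑ.ppSel p g (m + 1) = rstepSlot F N ϑ.ν ϑ.τ9 p g (m + 1) (ϑ.ppSel p g (m + 1)) := rfl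
  unfold classWeightOfDatum₉
  rw [hrec, hR]
  exact (sum_filter_integral_chi_mul_rstepSlot_int F N ϑ.ν ϑ.τ9 p g m (ϑ.ppSel p g (m + 1)) _ hm' h0' hint' hsupp' hsel π).trans
    (sum_fiber_integral_chi_tstepOfRecord F N ϑ.ν ϑ.τ9.M (wOfRecord₉ F N ϑ) p g m hm _ π hT hw hwb hχ hunit)

open scoped Classical in
/-- ★★★ **(T) AT AN IDENTITY-PINNED LEVEL, FROM UNITY + 𝐓-SIDE PROVISOS + INTEGRABLE NON-NEGATIVE MEASURABLE PRE-𝐑 PIECES ALONE.**  If `ϑ.ppSel p g (m+1)` fixes every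
sequence (the identity selector `ppSelIdOfRecord`; any tuple re-pinned there), then the a.e. support clause of `sum_fiber_classWeightOfDatum₉_succ_eq_int` is AUTOMATIC
(FILE 17's `suppClause_self_ae`: an integrable non-negative density vanishes a.e. where its own fibre integral does) and the pin is VOID, so
`Σ_{s′.init = π} classWeightOfDatum₉ ϑ D g₀ os p g (m+1) t s′ = classWeightOfDatum₉ ϑ D g₀ os p g m t π` follows from unity, the 𝐓-side provisos and: pre-𝐑 dressed pieces
measurable, non-negative, integrable. [cite: Balaban1988Convergent, (2.18) p.257, (3.24)–(3.25) p.270; Balaban1989LargeFieldI, (0.3)–(0.4) p.176 (at `Z″ = Z`)] -/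
theorem sum_fiber_classWeightOfDatum₉_succ_eq_of_sel_id (ϑ : Stage9Params F N) (D : FiniteEpsData F (SU N)) (g₀ : ℕ → ℝ) (os : List (ULoop F))
    (p : B12.RunParams) (g : ℕ → ℝ) (m : ℕ) (hm : m < p.K) (t : ℝ) (π : SeqOfRecord F ϑ.ν ϑ.τ9.M g p.K m)
    (hid : ∀ s', ϑ.ppSel p g (m + 1) s' = s')
    (hunit : IsStepUnity (avOfRecord F N p.K m).avg (chiSeqOfRecord F N ϑ.ν ϑ.τ9.M g p.K m)
      (chiSeqOfRecord F N ϑ.ν ϑ.τ9.M g p.K (m + 1)) (wOfRecord₉ F N ϑ p g m))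
    (hT : Integrable (fun U => chiSeqOfRecord F N ϑ.ν ϑ.τ9.M g p.K m π U * dressedSlotsOfDatum₉ F N ϑ D g₀ os t p g m π U)
      (fieldMeasure (F.P p.K) m (SU N)))
    (hw : ∀ s', Measurable
      (fun z : GaugeField (F.P p.K) (m + 1) (SU N) × GaugeField (F.P p.K) m (SU N) => wOfRecord₉ F N ϑ p g m s' z.2 z.1))
    (hwb : ∀ s' U V', |wOfRecord₉ F N ϑ p g m s' U V'| ≤ 1)
    (hχ : ∀ s', Measurable (chiSeqOfRecord F N ϑ.ν ϑ.τ9.M g p.K (m + 1) s'))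
    (hm' : ∀ s', Measurable (fun V => chiSeqOfRecord F N ϑ.ν ϑ.τ9.M g p.K (m + 1) s' V *
      tstepOfRecord F N ϑ.ν ϑ.τ9.M (wOfRecord₉ F N ϑ) p g m (dressedSlotsOfDatum₉ F N ϑ D g₀ os t p g m) s' V))
    (h0' : ∀ s' V, 0 ≤ chiSeqOfRecord F N ϑ.ν ϑ.τ9.M g p.K (m + 1) s' V *
      tstepOfRecord F N ϑ.ν ϑ.τ9.M (wOfRecord₉ F N ϑ) p g m (dressedSlotsOfDatum₉ F N ϑ D g₀ os t p g m) s' V)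
    (hint' : ∀ s', Integrable (fun V => chiSeqOfRecord F N ϑ.ν ϑ.τ9.M g p.K (m + 1) s' V *
      tstepOfRecord F N ϑ.ν ϑ.τ9.M (wOfRecord₉ F N ϑ) p g m (dressedSlotsOfDatum₉ F N ϑ D g₀ os t p g m) s' V) (fieldMeasure (F.P p.K) (m + 1) (SU N))) :
    ∑ s' ∈ Finset.univ.filter (fun s' : SeqOfRecord F ϑ.ν ϑ.τ9.M g p.K (m + 1) => s'.init = π),
        classWeightOfDatum₉ F N ϑ D g₀ os p g (m + 1) t s' = classWeightOfDatum₉ F N ϑ D g₀ os p g m t π := by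
  refine sum_fiber_classWeightOfDatum₉_succ_eq_int F N ϑ D g₀ os p g m hm t π hunit hT hw hwb hχ hm' h0' hint' (fun s' => ?_)
    (fun s' => Or.inl (by rw [hid]))
  rw [hid]
  exact suppClause_self_ae _ (hint' s') (ae_of_all _ (h0' s'))

end Literature.MathematicalPhysics.QuantumFieldTheory.Balaban1983to89.Node00

end
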